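import Summits.QuantumAdvantage.QuantumAdvantage.Statement
import Summits.QuantumAdvantage.QuantumAdvantage.Theorems.SoloBlindCeiling
import Summits.QuantumAdvantage.QuantumAdvantage.Theorems.SoloBlindLattice
import Literature.Computability.Complexity.TimeSpaceChainProofs
import Literature.Computability.Complexity.TimeSpaceProofs
import Literature.Computability.Complexity.CatalyticSpace
import Literature.Computability.Complexity.CatalyticSpaceLogspace
import Literature.Computability.Complexity.ProbabilisticClassesProofs
import HarnessLib

/-!
# The space rung of `QuantumAdvantage`: "`BQP ≠ L`" is open, and it is `Summit ∨ BPP ⊄ L`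

`QuantumAdvantage` is `¬ (BQP ⊆ BPP)` (`soloBlind_quantumAdvantage_iff_not_subset`). The lowest
class of the tree below `BPP` is `LOGSPACE` (`= L = DSPACE(log n)`), with the tree's PROVED
`LOGSPACE ⊆ P` (`LOGSPACE_subset_P_holds`) and `LOGSPACE ⊊ PSPACE` (`LOGSPACE_ssubset_PSPACE_holds`).
The sandwich identity of `SoloBlindLattice.lean` at `C = LOGSPACE` gives the SPACE RUNG

* `¬ (BQP ⊆ LOGSPACE) ↔ QuantumAdvantage ∨ ¬ (BPP ⊆ LOGSPACE)`  (`soloBlind_not_BQP_subset_LOGSPACE_iff`):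

"polynomial-time quantum computation cannot be carried out in deterministic logarithmic space"
is the summit OR the classical statement `BPP ⊄ L` (implied by `L ≠ P`, open since
Stearns–Hartmanis–Lewis 1965 / Cook 1971). Recorded sorry-free:

* the rung is INHERITED from `L ≠ P` (`soloBlind_LOGSPACE_rung_of_not_P_subset`; cf. `soloBlind_inherit_of_not_P_subset` of `SoloBlindFrontier.lean`), follows from the
  summit (`…_of_summit`) and — unlike "`BQP ≠ P`", which forces `P ≠ PSPACE`
  (`soloBlind_P_ne_PSPACE_of_not_BQP_subset_P`) — it HOLDS in the world `P = PSPACE`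
  (`soloBlind_LOGSPACE_rung_of_P_eq_PSPACE`, from the proved `L ⊊ PSPACE`);
* it fails exactly in the single world `L = P = BPP = BQP`
  (`soloBlind_BQP_subset_LOGSPACE_iff : BQP ⊆ L ↔ BQP ⊆ BPP ∧ BPP ⊆ P ∧ P ⊆ L`), a world no theorem
  I know refutes;
* one storey up, catalytic logspace `CL` (`L ⊆ CL ⊆ ZPP`, Buhrman–Cleve–Koucký–Loff–Speelman 2014)
  gives the rung `¬ (BQP ⊆ CL) ↔ Summit ∨ ¬ (BPP ⊆ CL)` modulo the tree's named fact `CL ⊆ ZPP`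
  (`soloBlind_not_BQP_subset_CL_iff`).

So even "`BQP ≠ L`" is an open consequence of the summit whose only known sufficient conditions
(`L ≠ P`, `P = PSPACE`, the summit) are classical or the summit itself. The still lower uniform
circuit rungs (`BQP ⊄` DLOGTIME-uniform `NC¹ ⊇ TC⁰ ⊇ ACC⁰ ⊇ AC⁰[6]`) have the same shape but no
uniform circuit classes exist in the tree; they are recorded in prose in the accompanying wall
(Allender 1999, Thm. 4: uniform `TC⁰ ⊊ C₌P ⊆ PP = PostBQP`, a counting-class bound that says
nothing about `BQP`).

References: R. E. Stearns, J. Hartmanis, P. M. Lewis II, *Hierarchies of memory limited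
computations*, FOCS 1965; S. Arora, B. Barak, *Computational Complexity* (2009), Thm. 4.2, §4.3,
Thm. 4.8; H. Buhrman, R. Cleve, M. Koucký, B. Loff, F. Speelman, *Computing with a full memory:
catalytic space*, STOC 2014, §1 (`L ⊆ CL ⊆ ZPP`); E. Allender, *The permanent requires large
uniform threshold circuits*, Chicago J. TCS 1999, Thm. 4.
-/

namespace Summit.QuantumAdvantage.QuantumAdvantage.Theorems

open Literature.Computability.Complexity Literature.Computability.Complexity.Classes
  Literature.Computability.Cryptography Literature.Computability.QuantumComplexity

/-- `L ⊆ BPP` (tree: `L ⊆ P ⊆ BPP`, both proved). -/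
theorem soloBlind_LOGSPACE_subset_BPP : LOGSPACE ⊆ BPP :=
  fun _ hL => P_subset_BPP_holds (LOGSPACE_subset_P_holds hL)

/-- **The space rung.** `BQP ⊄ L ↔ Summit ∨ BPP ⊄ L`. -/
theorem soloBlind_not_BQP_subset_LOGSPACE_iff :
    ¬ (BQP ⊆ LOGSPACE) ↔ _root_.QuantumAdvantage ∨ ¬ (BPP ⊆ LOGSPACE) :=
  soloBlind_below_iff soloBlind_LOGSPACE_subset_BPP

/-- The space rung is inherited from `L ≠ P` (as `P ⊄ L`). -/
theorem soloBlind_LOGSPACE_rung_of_not_P_subset (h : ¬ (P ⊆ LOGSPACE)) : ¬ (BQP ⊆ LOGSPACE) :=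
  fun hQ => h ((P_subset_BPP_holds.trans BPP_subset_BQP_holds).trans hQ)

/-- The space rung follows from the summit. -/
theorem soloBlind_LOGSPACE_rung_of_summit (h : _root_.QuantumAdvantage) : ¬ (BQP ⊆ LOGSPACE) :=
  soloBlind_below_of_summit soloBlind_LOGSPACE_subset_BPP h

/-- The space rung HOLDS in the world `P = PSPACE` (tree: `L ⊊ PSPACE`, proved by diagonalisation),
in contrast with "`BQP ≠ P`", which forces `P ≠ PSPACE`. -/
theorem soloBlind_LOGSPACE_rung_of_P_eq_PSPACE (h : P = PSPACE) : ¬ (BQP ⊆ LOGSPACE) := by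
  refine soloBlind_LOGSPACE_rung_of_not_P_subset fun hPL => ?_
  have hss : LOGSPACE ⊂ PSPACE := LOGSPACE_ssubset_PSPACE_holds
  exact hss.2 (h ▸ hPL)

/-- **The one world where the space rung fails:** `BQP ⊆ L` iff `L = P = BPP = BQP`
(as the three inclusions closing the proved chain `L ⊆ P ⊆ BPP ⊆ BQP`). -/
theorem soloBlind_BQP_subset_LOGSPACE_iff :
    BQP ⊆ LOGSPACE ↔ BQP ⊆ BPP ∧ BPP ⊆ P ∧ P ⊆ LOGSPACE := by
  constructor
  · intro h
    exact ⟨h.trans soloBlind_LOGSPACE_subset_BPP,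
      BPP_subset_BQP_holds.trans (h.trans LOGSPACE_subset_P_holds),
      (P_subset_BPP_holds.trans BPP_subset_BQP_holds).trans h⟩
  · rintro ⟨h₁, h₂, h₃⟩
    exact h₁.trans (h₂.trans h₃)

/-- In that world the summit fails and `P ≠ PSPACE` holds (so the space rung, like the
fixed-polynomial rungs, is implied by `P = PSPACE`). -/
theorem soloBlind_P_ne_PSPACE_of_BQP_subset_LOGSPACE (h : BQP ⊆ LOGSPACE) : P ≠ PSPACE :=
  fun he => soloBlind_LOGSPACE_rung_of_P_eq_PSPACE he h

/-- **Catalytic rung** (one storey up): modulo the named fact `CL ⊆ ZPP` (BCKLS 2014),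
`BQP ⊄ CL ↔ Summit ∨ BPP ⊄ CL`. -/
theorem soloBlind_not_BQP_subset_CL_iff (hCL : BCKLS2014_CL_subset_ZPP) :
    ¬ (BQP ⊆ CL) ↔ _root_.QuantumAdvantage ∨ ¬ (BPP ⊆ CL) :=
  soloBlind_below_iff
    (fun _ hL => (Set.inter_subset_left.trans RP_subset_BPP_holds) (hCL hL))

/-- … and the catalytic rung is inherited from the space rung's classical side one level up:
`P ⊄ CL → BQP ⊄ CL` (no fact needed). -/
theorem soloBlind_CL_rung_of_not_P_subset (h : ¬ (P ⊆ CL)) : ¬ (BQP ⊆ CL) :=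
  fun hQ => h ((P_subset_BPP_holds.trans BPP_subset_BQP_holds).trans hQ)

end Summit.QuantumAdvantage.QuantumAdvantage.Theorems
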